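import Summits.KontsevichZagierPeriods.KontsevichZagierPeriods.Theorems.HeckeMultiplicityOneManinStokesTileMap
import Summits.KontsevichZagierPeriods.KontsevichZagierPeriods.Theorems.HeckeMultiplicityOneManinStokesTileRamanujan

/-!
# `ManinStokes` (stmt-KontsevichZagierPeriods-5277): the inverse of `j` on the closed lower half plane

Support file (prover-owned, `--supports stmt-KontsevichZagierPeriods-5277`). `j` maps the closed half
fundamental domain `H = {z ∈ 𝒟 | 0 ≤ re z}` bijectively onto the closed lower half plane
(`kleinJ_injOn_halfFd`, `exists_mem_halfFd_kleinJ_eq`, `kleinJ_im_nonpos_of_mem_halfFd`). Any right inverse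
`ψ : {im u ≤ 0} → H` (they exist, `exists_tileInv`; no definition is introduced — every statement
quantifies over `ψ` with its characterising property) is

* continuous on the closed lower half plane (`continuousOn_tileInv`: compactness of truncated
  fundamental domains, Mathlib `ModularGroup.isCompact_truncatedFundamentalDomain`, the growth bound
  `exp_sub_le_norm_kleinJ : ‖j(z)‖ ≥ e^{2π im z} − 784`, and injectivity), and
* holomorphic on the open lower half plane with derivative `1/j'(ψ u)` (`hasDerivAt_coe_tileInv`,
  `differentiableOn_coe_tileInv`; Mathlib `HasDerivAt.of_local_left_inverse`), taking values in the open tile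
  there (`tileInv_mem_tile`), and on the real half-line `u > 1728` it is the axis point of
  `ModularSymbolRep` (`tileInv_of_gt`).

References: J.-P. Serre, *A Course in Arithmetic* (1973), VII §3.3. No definitions, no named facts.
-/

noncomputable section

open scoped MatrixGroups ModularForm Modular Manifold Topology
open CongruenceSubgroup Complex Set Filter MeasureTheory ModularForm
open UpperHalfPlane hiding I
open Literature.NumberTheory.EllipticCurves Literature.NumberTheory.EllipticCurves.ModularForms

namespace Summit.KontsevichZagierPeriods.HeckeMultiplicityOne.ManinStokes

/-! ### `j` maps the closed half domain onto the closed lower half plane -/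

/-- **`im j ≤ 0` on the closed half fundamental domain** `{z ∈ 𝒟 | 0 ≤ re z}`: negative on the open
tile, zero on the three edges `re z = 0`, `re z = 1/2`, `|z| = 1`. [folklore] -/
theorem kleinJ_im_nonpos_of_mem_halfFd {z : ℍ} (hz : z ∈ {z : ℍ | z ∈ 𝒟 ∧ 0 ≤ z.re}) :
    (kleinJ z).im ≤ 0 := by
  obtain ⟨⟨hn, hre⟩, hre0⟩ := hz
  rw [abs_le] at hre
  rcases hre0.eq_or_lt with h0 | h0
  · exact (kleinJ_im_eq_zero z (k := 0) (by rw [← h0]; norm_num)).le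
  rcases hre.2.eq_or_lt with h2 | h2
  · exact (kleinJ_im_eq_zero z (k := 1) (by rw [h2]; norm_num)).le
  rcases hn.eq_or_lt with h1 | h1
  · refine (kleinJ_im_eq_zero_of_norm_eq_one ?_).le
    have h2 : ‖(z : ℂ)‖ ^ 2 = 1 := by rw [← Complex.normSq_eq_norm_sq]; exact h1.symm
    exact (pow_eq_one_iff_of_nonneg (norm_nonneg _) two_ne_zero).mp h2
  · exact (kleinJ_im_neg_of_mem_tile ⟨h0, h2, h1⟩).le

/-- A point of the closed half domain at which `j` is not real lies in the open tile. [folklore] -/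
theorem mem_tile_of_mem_halfFd_of_im_ne_zero {z : ℍ} (hz : z ∈ {z : ℍ | z ∈ 𝒟 ∧ 0 ≤ z.re})
    (hj : (kleinJ z).im ≠ 0) : 0 < z.re ∧ z.re < 1 / 2 ∧ 1 < Complex.normSq (z : ℂ) := by
  obtain ⟨⟨hn, hre⟩, hre0⟩ := hz
  rw [abs_le] at hre
  refine ⟨hre0.lt_of_ne fun h0 => hj (kleinJ_im_eq_zero z (k := 0) (by rw [← h0]; norm_num)),
    hre.2.lt_of_ne fun h2 => hj (kleinJ_im_eq_zero z (k := 1) (by rw [h2]; norm_num)),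
    hn.lt_of_ne fun h1 => hj (kleinJ_im_eq_zero_of_norm_eq_one ?_)⟩
  have h2 : ‖(z : ℂ)‖ ^ 2 = 1 := by rw [← Complex.normSq_eq_norm_sq]; exact h1.symm
  exact (pow_eq_one_iff_of_nonneg (norm_nonneg _) two_ne_zero).mp h2

/-- The axis point `it`, `t ≥ 1`, lies in the closed half domain. [folklore] -/
theorem axisPt_mem_halfFd {t : ℝ} (ht : 1 ≤ t) : axisPt t ∈ {z : ℍ | z ∈ 𝒟 ∧ 0 ≤ z.re} := by
  have ht0 : 0 < t := one_pos.trans_le ht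
  refine ⟨⟨?_, ?_⟩, ?_⟩
  · rw [coe_axisPt ht0, Complex.normSq_apply]; simp; nlinarith
  · rw [re_axisPt ht0]; simp
  · rw [re_axisPt ht0]

/-- **`j` maps the closed half domain ONTO the closed lower half plane**: every `u` with `im u ≤ 0`
is `j(z)` for some `z ∈ {z ∈ 𝒟 | 0 ≤ re z}` (the open tile for `im u < 0`; the axis, the arc and the
line `re = 1/2` for real `u > 1728`, `0 ≤ u ≤ 1728`, `u ≤ 0`). [cite: Serre1973, VII §3.3 Prop. 5] -/
theorem exists_mem_halfFd_kleinJ_eq {u : ℂ} (hu : u.im ≤ 0) :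
    ∃ z ∈ {z : ℍ | z ∈ 𝒟 ∧ 0 ≤ z.re}, kleinJ z = u := by
  rcases hu.lt_or_eq with hlt | heq
  · obtain ⟨z, hz, hj⟩ := exists_mem_tile_kleinJ_eq hlt
    exact ⟨z, ⟨⟨hz.2.2.le, by rw [abs_le]; exact ⟨by linarith [hz.1], hz.2.1.le⟩⟩, hz.1.le⟩, hj⟩
  · -- real `u = x`
    have hux : u = (u.re : ℂ) := Complex.ext rfl (by simp [heq])
    set x := u.re with hx
    rcases lt_or_ge 1728 x with h1 | h1
    · obtain ⟨t, ht, htx⟩ := exists_axisJ_eq h1.le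
      refine ⟨axisPt t, axisPt_mem_halfFd ht, ?_⟩
      rw [kleinJ_axisPt (one_pos.trans_le ht), htx, ← hux]
    rcases lt_or_ge x 0 with h2 | h2
    · obtain ⟨t, ht, htx⟩ := exists_kleinJ_ofComplex_half_re_eq h2.le
      refine ⟨_, ofComplex_half_mem_halfFd ht, ?_⟩
      rw [hux, ← htx]
      exact Complex.ext rfl (by
        rw [Complex.ofReal_im, kleinJ_ofComplex_half_im (lt_of_lt_of_le (by positivity) ht)])
    · obtain ⟨θ, hθ, hθx⟩ := exists_kleinJ_ofComplex_exp_re_eq ⟨h2, h1⟩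
      obtain ⟨h0, hπ⟩ := pos_and_lt_pi_of_mem_Icc hθ
      refine ⟨_, ofComplex_exp_mem_halfFd hθ, ?_⟩
      rw [hux, ← hθx]
      exact Complex.ext rfl (by rw [Complex.ofReal_im, kleinJ_ofComplex_exp_im h0 hπ])

/-! ### The cusp: `|j(z)| ≥ e^{2π im z} − 784` for `im z ≥ 2` -/

/-- **Growth at the cusp**: `‖j(z)‖ ≥ e^{2π im z} − 784` for `im z ≥ 2` (`j = 1/q + 744 + O(q)`). [folklore] -/
theorem exp_sub_le_norm_kleinJ {z : ℍ} (hz : 2 ≤ z.im) : Real.exp (2 * Real.pi * z.im) - 784 ≤ ‖kleinJ z‖ := by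
  set q := Function.Periodic.qParam 1 (z : ℂ) with hq
  have hnq : ‖q‖ = Real.exp (-(2 * Real.pi * z.im)) := by
    rw [hq, Function.Periodic.norm_qParam]; simp
  have hqle : ‖q‖ ≤ 1 / 10 ^ 4 := by
    rw [hnq]
    refine le_trans (Real.exp_le_exp.mpr ?_) exp_neg_four_pi_le
    have := Real.pi_pos
    nlinarith
  have hest := norm_E₄_cube_div_discriminant_sub_sub_le z hqle
  change ‖kleinJ z - q⁻¹ - 744‖ ≤ _ at hest
  have h1 : ‖q⁻¹‖ = Real.exp (2 * Real.pi * z.im) := by rw [norm_inv, hnq, Real.exp_neg, inv_inv]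
  have h2 : ‖q⁻¹‖ ≤ ‖kleinJ z‖ + ‖kleinJ z - q⁻¹ - 744‖ + 744 := by
    have := norm_sub_le (kleinJ z - 744) (kleinJ z - q⁻¹ - 744)
    rw [show kleinJ z - 744 - (kleinJ z - q⁻¹ - 744) = q⁻¹ by ring] at this
    have h3 : ‖kleinJ z - 744‖ ≤ ‖kleinJ z‖ + 744 := by
      refine (norm_sub_le _ _).trans ?_; simp
    linarith
  have h4 : 400000 * ‖q‖ ≤ 40 := by linarith
  linarith

/-- Points of the closed half domain with bounded `j` have bounded height: if `‖j(z)‖ ≤ R` then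
`im z ≤ max 2 ((R + 784) / 6)`. [folklore] -/
theorem im_le_of_norm_kleinJ_le {z : ℍ} {R : ℝ} (h : ‖kleinJ z‖ ≤ R) : z.im ≤ max 2 ((R + 784) / 6) := by
  by_contra hlt
  rw [not_le, max_lt_iff] at hlt
  have hb := exp_sub_le_norm_kleinJ hlt.1.le
  have h5 := Real.add_one_le_exp (2 * Real.pi * z.im)
  have h6 : 6 * z.im ≤ 2 * Real.pi * z.im := by
    have := Real.pi_gt_three
    have := z.im_pos
    nlinarith
  linarith [hlt.2]

/-! ### The inverse map `ψ : {im u ≤ 0} → {z ∈ 𝒟 | 0 ≤ re z}` (any right inverse of `j`) -/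

/-- **Existence of the inverse**: a right inverse `ψ` of `j` on the closed lower half plane with values
in the closed half domain (unique there by `kleinJ_injOn_halfFd`). [folklore] -/
theorem exists_tileInv : ∃ ψ : ℂ → ℍ, ∀ u : ℂ, u.im ≤ 0 →
    ψ u ∈ {z : ℍ | z ∈ 𝒟 ∧ 0 ≤ z.re} ∧ kleinJ (ψ u) = u := by
  classical
  refine ⟨fun u => if hu : u.im ≤ 0 then (exists_mem_halfFd_kleinJ_eq hu).choose else UpperHalfPlane.I,
    fun u hu => ?_⟩
  simp only [hu, dif_pos]
  exact (exists_mem_halfFd_kleinJ_eq hu).choose_spec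

/-- The inverse recovers every point of the closed half domain: `ψ (j z) = z`. [folklore] -/
theorem tileInv_kleinJ {ψ : ℂ → ℍ}
    (hψ : ∀ u : ℂ, u.im ≤ 0 → ψ u ∈ {z : ℍ | z ∈ 𝒟 ∧ 0 ≤ z.re} ∧ kleinJ (ψ u) = u)
    {z : ℍ} (hz : z ∈ {z : ℍ | z ∈ 𝒟 ∧ 0 ≤ z.re}) : ψ (kleinJ z) = z :=
  kleinJ_injOn_halfFd (hψ _ (kleinJ_im_nonpos_of_mem_halfFd hz)).1 hz
    (hψ _ (kleinJ_im_nonpos_of_mem_halfFd hz)).2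

/-- For `im u < 0` the inverse point lies in the open tile `τ₀`. [folklore] -/
theorem tileInv_mem_tile {ψ : ℂ → ℍ}
    (hψ : ∀ u : ℂ, u.im ≤ 0 → ψ u ∈ {z : ℍ | z ∈ 𝒟 ∧ 0 ≤ z.re} ∧ kleinJ (ψ u) = u)
    {u : ℂ} (hu : u.im < 0) :
    0 < (ψ u).re ∧ (ψ u).re < 1 / 2 ∧ 1 < Complex.normSq ((ψ u : ℍ) : ℂ) :=
  mem_tile_of_mem_halfFd_of_im_ne_zero (hψ u hu.le).1 (by rw [(hψ u hu.le).2]; exact hu.ne)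

/-- On the real half-line `u > 1728` the inverse is the axis point `i t₊(u)` of `ModularSymbolRep`. [folklore] -/
theorem tileInv_of_gt {ψ : ℂ → ℍ}
    (hψ : ∀ u : ℂ, u.im ≤ 0 → ψ u ∈ {z : ℍ | z ∈ 𝒟 ∧ 0 ≤ z.re} ∧ kleinJ (ψ u) = u)
    {x : ℝ} (hx : 1728 < x) : ψ (x : ℂ) = axisPt (axisParam x) := by
  have h := tileInv_kleinJ hψ (axisPt_mem_halfFd (one_lt_axisParam hx).le)
  rwa [kleinJ_axisPt_axisParam hx] at h

/-- **Continuity of the inverse on the closed lower half plane** (within it), by compactness: near `u₀`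
the inverse points stay in a truncated half domain (`im_le_of_norm_kleinJ_le`, compact by Mathlib's
`isCompact_truncatedFundamentalDomain`), on which any cluster point `z*` of `ψ` has `j(z*) = u₀`, hence
`z* = ψ u₀` (`kleinJ_injOn_halfFd`). [folklore] -/
theorem continuousOn_tileInv {ψ : ℂ → ℍ}
    (hψ : ∀ u : ℂ, u.im ≤ 0 → ψ u ∈ {z : ℍ | z ∈ 𝒟 ∧ 0 ≤ z.re} ∧ kleinJ (ψ u) = u) :
    ContinuousOn ψ {u : ℂ | u.im ≤ 0} := by
  intro u₀ hu₀
  set S := {u : ℂ | u.im ≤ 0} with hS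
  set M : ℝ := max 2 ((‖u₀‖ + 1 + 784) / 6) with hM
  set K : Set ℍ := ModularGroup.truncatedFundamentalDomain M ∩ {z : ℍ | 0 ≤ z.re} with hK
  have hKc : IsCompact K := (ModularGroup.isCompact_truncatedFundamentalDomain M).inter_right
    (isClosed_le continuous_const UpperHalfPlane.continuous_re)
  have hKH : K ⊆ {z : ℍ | z ∈ 𝒟 ∧ 0 ≤ z.re} := fun z hz => ⟨hz.1.1, hz.2⟩
  -- eventually the inverse points lie in `K`
  have hmem : ∀ᶠ u in 𝓝[S] u₀, ψ u ∈ K := by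
    have hball : ∀ᶠ u in 𝓝[S] u₀, u ∈ S ∧ ‖u‖ < ‖u₀‖ + 1 := by
      refine Filter.eventually_of_mem (inter_mem_nhdsWithin S
        (Metric.ball_mem_nhds u₀ one_pos)) ?_
      rintro u ⟨huS, hu⟩
      refine ⟨huS, ?_⟩
      have := mem_ball_iff_norm.mp hu
      linarith [norm_le_norm_add_norm_sub' u u₀, norm_sub_rev u u₀]
    filter_upwards [hball] with u hu
    obtain ⟨hH, hj⟩ := hψ u hu.1
    refine ⟨⟨hH.1, ?_⟩, hH.2⟩
    exact im_le_of_norm_kleinJ_le (by rw [hj]; exact hu.2.le)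
  refine hKc.tendsto_nhds_of_unique_mapClusterPt hmem fun z hzK hcl => ?_
  -- a cluster point `z` has `j z = u₀`
  have hj : ClusterPt (kleinJ z) (map kleinJ (map ψ (𝓝[S] u₀))) :=
    hcl.clusterPt.map continuous_kleinJ.continuousAt tendsto_map
  rw [Filter.map_map] at hj
  have hle : map (kleinJ ∘ ψ) (𝓝[S] u₀) ≤ 𝓝 u₀ := by
    have : (kleinJ ∘ ψ) =ᶠ[𝓝[S] u₀] id := by
      filter_upwards [self_mem_nhdsWithin] with u hu
      exact (hψ u hu).2
    rw [Filter.map_congr this, Filter.map_id]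
    exact nhdsWithin_le_nhds
  have hju : kleinJ z = u₀ := by
    have h2 : ClusterPt (kleinJ z) (𝓝 u₀) := hj.mono hle
    exact t2_iff_nhds.mp inferInstance h2
  have hz0 := tileInv_kleinJ hψ (hKH hzK)
  rw [hju] at hz0
  exact hz0.symm

/-- The open lower half plane is open. [folklore] -/
theorem isOpen_im_neg : IsOpen {u : ℂ | u.im < 0} := isOpen_lt Complex.continuous_im continuous_const

/-- At a point with `im u < 0` the inverse is continuous (as a map to `ℂ`). [folklore] -/
theorem continuousAt_coe_tileInv {ψ : ℂ → ℍ}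
    (hψ : ∀ u : ℂ, u.im ≤ 0 → ψ u ∈ {z : ℍ | z ∈ 𝒟 ∧ 0 ≤ z.re} ∧ kleinJ (ψ u) = u)
    {u : ℂ} (hu : u.im < 0) : ContinuousAt (fun w => ((ψ w : ℍ) : ℂ)) u :=
  UpperHalfPlane.continuous_coe.continuousAt.comp
    ((continuousOn_tileInv hψ).continuousAt
      (mem_of_superset (isOpen_im_neg.mem_nhds hu) fun w hw => le_of_lt (show w.im < 0 from hw)))

/-- `j' ≠ 0` at the inverse point of a non-real value (no elliptic points in the open tile:
`E₄ = 0` only on the orbit of `ρ` where `j = 0`, `E₆ = 0` only on the orbit of `i` where `j = 1728`). [folklore] -/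
theorem deriv_kleinJ_tileInv_ne_zero {ψ : ℂ → ℍ}
    (hψ : ∀ u : ℂ, u.im ≤ 0 → ψ u ∈ {z : ℍ | z ∈ 𝒟 ∧ 0 ≤ z.re} ∧ kleinJ (ψ u) = u)
    {u : ℂ} (hu : u.im < 0) : deriv (kleinJ ∘ ofComplex) (ψ u) ≠ 0 := by
  rw [deriv_kleinJ_ne_zero_iff]
  have hj := (hψ u hu.le).2
  constructor
  · intro h
    obtain ⟨γ, hγ⟩ := E₄_eq_zero_iff.mp h
    have : kleinJ (ψ u) = 0 := by rw [← hγ, kleinJ_smul, kleinJ_rho]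
    rw [hj] at this
    rw [this] at hu
    simp at hu
  · intro h
    obtain ⟨γ, hγ⟩ := E₆_eq_zero_iff.mp h
    have : kleinJ (ψ u) = 1728 := by rw [← hγ, kleinJ_smul, kleinJ_I]
    rw [hj] at this
    rw [this] at hu
    norm_num at hu

/-- **The inverse is holomorphic on the open lower half plane**, with derivative `1/j'(ψ u)`
(the easy half of the inverse function theorem, Mathlib `HasDerivAt.of_local_left_inverse`, given the
continuity `continuousOn_tileInv`). [folklore] -/
theorem hasDerivAt_coe_tileInv {ψ : ℂ → ℍ}
    (hψ : ∀ u : ℂ, u.im ≤ 0 → ψ u ∈ {z : ℍ | z ∈ 𝒟 ∧ 0 ≤ z.re} ∧ kleinJ (ψ u) = u)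
    {u : ℂ} (hu : u.im < 0) :
    HasDerivAt (fun w => ((ψ w : ℍ) : ℂ)) (deriv (kleinJ ∘ ofComplex) (ψ u))⁻¹ u := by
  have hf : HasDerivAt (kleinJ ∘ ofComplex) (deriv (kleinJ ∘ ofComplex) (ψ u)) ((ψ u : ℍ) : ℂ) :=
    (differentiableOn_kleinJ.differentiableAt
      ((isOpen_lt continuous_const Complex.continuous_im).mem_nhds (ψ u).im_pos)).hasDerivAt
  refine hf.of_local_left_inverse (continuousAt_coe_tileInv hψ hu) (deriv_kleinJ_tileInv_ne_zero hψ hu) ?_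
  filter_upwards [isOpen_im_neg.mem_nhds hu] with w hw
  rw [Function.comp_apply, UpperHalfPlane.ofComplex_apply, (hψ w (le_of_lt hw)).2]

/-- The inverse is complex differentiable on the open lower half plane. [folklore] -/
theorem differentiableOn_coe_tileInv {ψ : ℂ → ℍ}
    (hψ : ∀ u : ℂ, u.im ≤ 0 → ψ u ∈ {z : ℍ | z ∈ 𝒟 ∧ 0 ≤ z.re} ∧ kleinJ (ψ u) = u) :
    DifferentiableOn ℂ (fun w => ((ψ w : ℍ) : ℂ)) {u : ℂ | u.im < 0} := fun _ hu =>
  (hasDerivAt_coe_tileInv hψ hu).differentiableAt.differentiableWithinAt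



/-! ### The integrand `G = (ω/dj) ∘ ψ` on the closed lower half plane -/

/-- `E₄ ≠ 0` at the inverse point of `u ≠ 0` (`E₄ = 0` exactly on the orbit of `ρ`, where `j = 0`). [folklore] -/
theorem E₄_tileInv_ne_zero {ψ : ℂ → ℍ}
    (hψ : ∀ u : ℂ, u.im ≤ 0 → ψ u ∈ {z : ℍ | z ∈ 𝒟 ∧ 0 ≤ z.re} ∧ kleinJ (ψ u) = u)
    {u : ℂ} (hu : u.im ≤ 0) (h0 : u ≠ 0) : E₄ (ψ u) ≠ 0 := by
  intro h
  obtain ⟨γ, hγ⟩ := E₄_eq_zero_iff.mp h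
  have : kleinJ (ψ u) = 0 := by rw [← hγ, kleinJ_smul, kleinJ_rho]
  rw [(hψ u hu).2] at this
  exact h0 this

/-- `E₆ ≠ 0` at the inverse point of `u ≠ 1728` (`E₆ = 0` exactly on the orbit of `i`, where `j = 1728`). [folklore] -/
theorem E₆_tileInv_ne_zero {ψ : ℂ → ℍ}
    (hψ : ∀ u : ℂ, u.im ≤ 0 → ψ u ∈ {z : ℍ | z ∈ 𝒟 ∧ 0 ≤ z.re} ∧ kleinJ (ψ u) = u)
    {u : ℂ} (hu : u.im ≤ 0) (h1 : u ≠ 1728) : E₆ (ψ u) ≠ 0 := by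
  intro h
  obtain ⟨γ, hγ⟩ := E₆_eq_zero_iff.mp h
  have : kleinJ (ψ u) = 1728 := by rw [← hγ, kleinJ_smul, kleinJ_I]
  rw [(hψ u hu).2] at this
  exact h1 this

/-- **`G = (ω/dj) ∘ ψ` is continuous on the closed lower half plane off `{0, 1728}`.** [folklore] -/
theorem continuousOn_djQuot_tileInv {ψ : ℂ → ℍ}
    (hψ : ∀ u : ℂ, u.im ≤ 0 → ψ u ∈ {z : ℍ | z ∈ 𝒟 ∧ 0 ≤ z.re} ∧ kleinJ (ψ u) = u)
    {φ : ℍ → ℂ} (hφ : MDifferentiable 𝓘(ℂ) 𝓘(ℂ) φ) :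
    ContinuousOn (fun u => djQuot φ (ψ u)) {u : ℂ | u.im ≤ 0 ∧ u ≠ 0 ∧ u ≠ 1728} :=
  (continuousOn_djQuot hφ).comp ((continuousOn_tileInv hψ).mono fun _ hu => hu.1) fun _ hu =>
    ⟨E₄_tileInv_ne_zero hψ hu.1 hu.2.1, E₆_tileInv_ne_zero hψ hu.1 hu.2.2⟩

/-- **`G = (ω/dj) ∘ ψ` is holomorphic on the open lower half plane** (chain rule with the holomorphic
inverse `hasDerivAt_coe_tileInv`). [folklore] -/
theorem differentiableOn_djQuot_tileInv {ψ : ℂ → ℍ}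
    (hψ : ∀ u : ℂ, u.im ≤ 0 → ψ u ∈ {z : ℍ | z ∈ 𝒟 ∧ 0 ≤ z.re} ∧ kleinJ (ψ u) = u)
    {φ : ℍ → ℂ} (hφ : MDifferentiable 𝓘(ℂ) 𝓘(ℂ) φ) :
    DifferentiableOn ℂ (fun u => djQuot φ (ψ u)) {u : ℂ | u.im < 0} := by
  intro u hu
  have hu' : u.im < 0 := hu
  have h0 : u ≠ 0 := fun h => by rw [h] at hu'; simp at hu'
  have h1 : u ≠ 1728 := fun h => by rw [h] at hu'; norm_num at hu'
  have hd := differentiableAt_djQuot_comp_ofComplex hφ (E₄_tileInv_ne_zero hψ hu'.le h0)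
    (E₆_tileInv_ne_zero hψ hu'.le h1)
  have hcomp := hd.comp u (hasDerivAt_coe_tileInv hψ hu').differentiableAt
  have heq : (djQuot φ ∘ ofComplex) ∘ (fun w => ((ψ w : ℍ) : ℂ)) = fun w => djQuot φ (ψ w) := by
    funext w; simp [Function.comp_apply, UpperHalfPlane.ofComplex_apply]
  rw [heq] at hcomp
  exact hcomp.differentiableWithinAt

/-- The complex derivative of `G` at an interior point (chain rule): `(ω/dj)'(ψ u) · ψ'(u)` with
`ψ' = 1/j'(ψ u)`. [folklore] -/
theorem hasDerivAt_djQuot_tileInv {ψ : ℂ → ℍ}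
    (hψ : ∀ u : ℂ, u.im ≤ 0 → ψ u ∈ {z : ℍ | z ∈ 𝒟 ∧ 0 ≤ z.re} ∧ kleinJ (ψ u) = u)
    {φ : ℍ → ℂ} (hφ : MDifferentiable 𝓘(ℂ) 𝓘(ℂ) φ) {u : ℂ} (hu : u.im < 0) :
    HasDerivAt (fun w => djQuot φ (ψ w))
      (deriv (djQuot φ ∘ ofComplex) (ψ u) * (deriv (kleinJ ∘ ofComplex) (ψ u))⁻¹) u := by
  have h0 : u ≠ 0 := fun h => by rw [h] at hu; simp at hu
  have h1 : u ≠ 1728 := fun h => by rw [h] at hu; norm_num at hu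
  have hd := differentiableAt_djQuot_comp_ofComplex hφ (E₄_tileInv_ne_zero hψ hu.le h0)
    (E₆_tileInv_ne_zero hψ hu.le h1)
  have hcomp := hd.hasDerivAt.comp u (hasDerivAt_coe_tileInv hψ hu)
  have heq : (djQuot φ ∘ ofComplex) ∘ (fun w => ((ψ w : ℍ) : ℂ)) = fun w => djQuot φ (ψ w) := by
    funext w; simp [Function.comp_apply, UpperHalfPlane.ofComplex_apply]
  rw [heq] at hcomp
  exact hcomp

end Summit.KontsevichZagierPeriods.HeckeMultiplicityOne.ManinStokes
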